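import Mathlib
import Literature.RingTheory.Elimination.PerturbedCharpolyIsolated
import Literature.RingTheory.Elimination.GenericSquareCombinations
import Literature.RingTheory.Elimination.TopComponents

/-!
# LangWeilTransfer, support item `TameResolution` (stmt-ValiantsHypothesis-6378) — preliminaries
# for the relative eliminant identity: leading `s`-forms under maps, indeterminates, the dichotomy

Route `LangWeilTransfer` of `ValiantsHypothesis` (conditional route; honest framing: bookkeeping,
nothing here bears on VP ≠ VNP). Setting ((R) of the architecture note of val-lit-p6 g9): a
system `S_1, …, S_t ∈ ℤ[T_1..T_r][X_1..X_n]` (the original equations in coordinates split into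
parameters `T` and fibre variables `X`), and a ring homomorphism `φ : ℤ[T][X] → F₀` to a field
(evaluation at the generic point `(T̄, ξ)` of a component `V(𝔭)`, `𝔭 = ker φ`) such that
`ℤ[T] → F₀` is injective (`T̄` algebraically independent), every `ξ_j = φ(X_j)` is algebraic over
`ℤ[T̄]`, the `S_k` vanish at the point, and `ker φ` is the only prime between `(S)` and `ker φ`
(minimality of the component). Over the universal coefficient ring
`R_u = ℤ[T, α_{ik}, Λ_j]` form the square system `F_i = Σ_k α_{ik} S_k`, the generic linear form
`u = Σ_j Λ_j X_j`, and `Q = sLead (pertCharpoly (d+1) F u k₀) ∈ R_u[U]` (Canny's generalised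
characteristic polynomial, tree `PerturbedCharpoly.lean`).

* `eliminant_identity` — **`Q(T̄, α, Λ, Σ_j Λ_j ξ_j) = 0` identically in `F₀[α, Λ]`.**

Proof: over `K₂` = algebraic closure of `K₁(α)` (`K₁ = F₀^alg`, `α` indeterminates, a
transcendence basis of `K₂/K₁`) the point `ξ` is an ISOLATED zero of `F^{K₂}`: a prime `P` with
`(F) ⊆ P ⊆ 𝔪_ξ` either misses some `S_k` — then it is maximal by
`isMaximal_of_generic_combinations` (transcendence degree) — or contains `(S)`, contracts to
`ker φ` by minimality, hence contains the images of the coordinate equations of the `ξ_j`, has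
finite zero set and is maximal (`isMaximal_of_zeroLocus_finite`). So the local limit lemma
`eval_sLead_pertCharpoly_eq_zero_of_isolated` gives `Q(…, Σ c_j ξ_j) = 0` for every `c ∈ K₂ⁿ`,
a polynomial identity in `Λ` over `K₂`, which descends to `F₀[α, Λ]` because `α` is algebraically
independent over `F₀`.
-/

noncomputable section

open MvPolynomial
open Literature.RingTheory.Elimination

-- the summit and the problem share the name `ValiantsHypothesis` (D-0017 single-conjunct layout)
set_option linter.dupNamespace false

namespace Summit.ValiantsHypothesis.ValiantsHypothesis.Theorems.LangWeilTransfer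

/-! ### The leading `s`-form under a change of coefficients -/

section SLeadMap

variable {R K : Type*} [CommRing R] [CommRing K]

/-- The `s`-degree of the coefficients can only drop under a ring homomorphism. -/
theorem sDeg_map_le (ψ : R →+* K) (P : Polynomial (Polynomial R)) :
    sDeg (P.map (Polynomial.mapRingHom ψ)) ≤ sDeg P := by
  unfold sDeg
  refine Finset.sup_le fun k hk => ?_
  rw [Polynomial.coeff_map, Polynomial.coe_mapRingHom]
  exact (Polynomial.natDegree_map_le).trans (natDegree_coeff_le_sDeg P k)

/-- **The leading `s`-form under a change of coefficients.** For `ψ : R → K` and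
`P ∈ R[s][U]`: if the leading `s`-form of the mapped polynomial vanishes at `x`, so does the
image of the leading `s`-form (when the `s`-degree drops, the image is identically zero). -/
theorem eval_map_sLead_eq_zero (ψ : R →+* K) (P : Polynomial (Polynomial R)) (x : K)
    (h : (sLead (P.map (Polynomial.mapRingHom ψ))).eval x = 0) :
    ((sLead P).map ψ).eval x = 0 := by
  set P' := P.map (Polynomial.mapRingHom ψ) with hP'
  have hcoeff : ∀ k j, (P'.coeff k).coeff j = ψ ((P.coeff k).coeff j) := by
    intro k j
    rw [hP', Polynomial.coeff_map, Polynomial.coe_mapRingHom, Polynomial.coeff_map]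
  by_cases hdeg : sDeg P' = sDeg P
  · -- same `s`-degree: the leading forms correspond
    have heq : (sLead P).map ψ = sLead P' := by
      ext k
      rw [Polynomial.coeff_map, coeff_sLead, coeff_sLead, hcoeff, hdeg]
    rw [heq]; exact h
  · -- the `s`-degree drops: the image of the leading form is zero
    have hlt : sDeg P' < sDeg P := lt_of_le_of_ne (sDeg_map_le ψ P) hdeg
    have heq : (sLead P).map ψ = 0 := by
      ext k
      rw [Polynomial.coeff_map, coeff_sLead, Polynomial.coeff_zero, ← hcoeff]
      exact Polynomial.coeff_eq_zero_of_natDegree_lt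
        (lt_of_le_of_lt (natDegree_coeff_le_sDeg P' k) hlt)
    rw [heq, Polynomial.eval_zero]

end SLeadMap

/-! ### The transcendence basis of indeterminates -/

section Indeterminates

variable (K₁ : Type*) [Field K₁] (σ : Type*)

/-- The indeterminates `α_p`, viewed in an algebraic closure `K₂` of the rational function field
`K₁(α_σ)`, form a transcendence basis of `K₂` over `K₁`. -/
theorem isTranscendenceBasis_genVar :
    IsTranscendenceBasis K₁ (fun p : σ =>
      algebraMap (FractionRing (MvPolynomial σ K₁)) (AlgebraicClosure (FractionRing (MvPolynomial σ K₁)))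
        (algebraMap (MvPolynomial σ K₁) (FractionRing (MvPolynomial σ K₁)) (X p))) := by
  have h1 : IsTranscendenceBasis K₁ (X (R := K₁) (σ := σ)) := IsTranscendenceBasis.mvPolynomial σ K₁
  haveI : Algebra.IsAlgebraic (MvPolynomial σ K₁) (FractionRing (MvPolynomial σ K₁)) :=
    IsLocalization.isAlgebraic _ (nonZeroDivisors (MvPolynomial σ K₁))
  have h2 : IsTranscendenceBasis K₁
      (algebraMap (MvPolynomial σ K₁) (FractionRing (MvPolynomial σ K₁)) ∘ X (R := K₁) (σ := σ)) :=
    h1.algebraMap_comp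
  exact h2.algebraMap_comp (A := AlgebraicClosure (FractionRing (MvPolynomial σ K₁)))

end Indeterminates

/-! ### Maximality of the primes below the point -/

section Dichotomy

variable {F₀ : Type*} [Field F₀] {r n t : ℕ}

/-- **The dichotomy.** In the setting of the module docstring, over an algebraically closed `K₂`
containing `F₀` and a transcendence basis `α` of `K₂/K₁` (`K₁ ⊇ F₀` a subfield of `K₂` containing
the coefficients): every prime `P ⊇ (F^{K₂})` of `K₂[X]` below the ideal of the point `ξ` is
maximal — either some `S_k ∉ P` (generic combinations, transcendence degree) or `(S) ⊆ P`, and then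
`P` contracts to `ker φ`, contains the coordinate equations of `ξ` and has finite zero set. -/
theorem isMaximal_of_le_point {K₁ K₂ : Type*} [Field K₁] [Field K₂] [IsAlgClosed K₂] [Algebra K₁ K₂]
    (j₁ : F₀ →+* K₁) (S : Fin t → MvPolynomial (Fin n) (MvPolynomial (Fin r) ℤ))
    (φ : MvPolynomial (Fin n) (MvPolynomial (Fin r) ℤ) →+* F₀)
    (hT : Function.Injective (φ.comp MvPolynomial.C))
    (halg : ∀ j, ∃ P : Polynomial (MvPolynomial (Fin r) ℤ), P ≠ 0 ∧
      (P.map (φ.comp MvPolynomial.C)).eval (φ (X j)) = 0)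
    (hmin : ∀ 𝔮 : Ideal (MvPolynomial (Fin n) (MvPolynomial (Fin r) ℤ)), 𝔮.IsPrime →
      Ideal.span (Set.range S) ≤ 𝔮 → 𝔮 ≤ RingHom.ker φ → 𝔮 = RingHom.ker φ)
    (α : Fin n × Fin t → K₂) (hα : IsTranscendenceBasis K₁ α)
    (P : Ideal (MvPolynomial (Fin n) K₂)) [hP : P.IsPrime]
    (hFP : ∀ i, (∑ k, C (α (i, k)) * MvPolynomial.map (algebraMap K₁ K₂)
      (MvPolynomial.map (j₁.comp (φ.comp MvPolynomial.C)) (S k))) ∈ P)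
    (hPξ : P ≤ vanishingIdeal K₂ {fun j => algebraMap K₁ K₂ (j₁ (φ (X j)))}) :
    P.IsMaximal := by
  classical
  set θ₁ : MvPolynomial (Fin r) ℤ →+* K₁ := j₁.comp (φ.comp MvPolynomial.C) with hθ₁
  set θ₂ : MvPolynomial (Fin r) ℤ →+* K₂ := (algebraMap K₁ K₂).comp θ₁ with hθ₂
  set jK : F₀ →+* K₂ := (algebraMap K₁ K₂).comp j₁ with hjK
  set ξ₂ : Fin n → K₂ := fun j => algebraMap K₁ K₂ (j₁ (φ (X j))) with hξ₂
  set S₁ : Fin t → MvPolynomial (Fin n) K₁ := fun k => MvPolynomial.map θ₁ (S k) with hS₁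
  by_cases hcase : ∃ k₀, MvPolynomial.map (algebraMap K₁ K₂) (S₁ k₀) ∉ P
  · obtain ⟨k₀, hk₀⟩ := hcase
    exact isMaximal_of_generic_combinations α hα S₁ P hFP hk₀
  · push Not at hcase
    -- the contraction of `P` is `ker φ`
    set Φ : MvPolynomial (Fin n) (MvPolynomial (Fin r) ℤ) →+* MvPolynomial (Fin n) K₂ :=
      MvPolynomial.map θ₂ with hΦ
    have hΦS : ∀ k, Φ (S k) = MvPolynomial.map (algebraMap K₁ K₂) (S₁ k) := by
      intro k
      rw [hΦ, hS₁]; dsimp only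
      rw [MvPolynomial.map_map]
    have hevΦ : ∀ g, eval ξ₂ (Φ g) = jK (φ g) := by
      intro g
      have : (eval ξ₂).comp Φ = jK.comp φ := by
        refine MvPolynomial.ringHom_ext (fun b => ?_) (fun j => ?_)
        · rw [RingHom.comp_apply, hΦ, MvPolynomial.map_C, eval_C, RingHom.comp_apply]
          rfl
        · rw [RingHom.comp_apply, hΦ, MvPolynomial.map_X, eval_X, RingHom.comp_apply]
          rfl
      exact congrArg (fun h => h g) this
    set 𝔮 : Ideal (MvPolynomial (Fin n) (MvPolynomial (Fin r) ℤ)) := P.comap Φ with h𝔮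
    have h𝔮prime : 𝔮.IsPrime := Ideal.IsPrime.comap Φ
    have hS𝔮 : Ideal.span (Set.range S) ≤ 𝔮 := by
      rw [Ideal.span_le]
      rintro _ ⟨k, rfl⟩
      rw [SetLike.mem_coe, h𝔮, Ideal.mem_comap, hΦS]
      exact hcase k
    have h𝔮ker : 𝔮 ≤ RingHom.ker φ := by
      intro g hg
      rw [RingHom.mem_ker]
      have h1 : Φ g ∈ vanishingIdeal K₂ {ξ₂} := hPξ hg
      rw [mem_vanishingIdeal_singleton_iff, aeval_eq_eval, hevΦ] at h1
      exact jK.injective (by rw [h1, map_zero])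
    have h𝔮eq : 𝔮 = RingHom.ker φ := hmin 𝔮 h𝔮prime hS𝔮 h𝔮ker
    -- the zero set of `P` is finite: each coordinate is a root of a fixed non-zero polynomial
    have hθ₂inj : Function.Injective θ₂ := (algebraMap K₁ K₂).injective.comp (j₁.injective.comp hT)
    choose Pj hPj0 hPjev using halg
    have hroot : ∀ x ∈ zeroLocus K₂ P, ∀ j, x j ∈ ((Pj j).map θ₂).roots := by
      intro x hx j
      have hne : (Pj j).map θ₂ ≠ 0 := fun h0 =>
        hPj0 j (Polynomial.map_injective θ₂ hθ₂inj (by rw [h0, Polynomial.map_zero]))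
      rw [Polynomial.mem_roots hne, Polynomial.IsRoot.def]
      -- the coordinate equation lies in `ker φ = 𝔮`, so its image lies in `P`
      set e : MvPolynomial (Fin n) (MvPolynomial (Fin r) ℤ) :=
        Polynomial.eval₂ (MvPolynomial.C) (X j) (Pj j) with he
      have heker : e ∈ RingHom.ker φ := by
        rw [RingHom.mem_ker, he, Polynomial.hom_eval₂, ← Polynomial.eval_map]
        exact hPjev j
      have heP : Φ e ∈ P := by
        have : e ∈ 𝔮 := by rw [h𝔮eq]; exact heker
        rw [h𝔮, Ideal.mem_comap] at this
        exact this
      have hxe : aeval x (Φ e) = 0 := hx _ heP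
      rw [aeval_eq_eval, he, Polynomial.hom_eval₂, Polynomial.hom_eval₂, ← Polynomial.eval_map] at hxe
      have hcomp : ((eval x).comp (Φ.comp MvPolynomial.C)) = θ₂ := by
        refine RingHom.ext fun b => ?_
        simp only [RingHom.comp_apply, hΦ, MvPolynomial.map_C, MvPolynomial.eval_C]
      rw [hcomp] at hxe
      have hX : (eval x) (Φ (X j)) = x j := by rw [hΦ, MvPolynomial.map_X, eval_X]
      rw [hX] at hxe
      exact hxe
    have hfin : (zeroLocus K₂ P).Finite := by
      refine (Set.Finite.pi (t := fun j => (((Pj j).map θ₂).roots.toFinset : Set K₂))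
        (fun j => Finset.finite_toSet _)).subset ?_
      intro x hx
      rw [Set.mem_univ_pi]
      intro j
      rw [Finset.mem_coe, Multiset.mem_toFinset]
      exact hroot x hx j
    exact isMaximal_of_zeroLocus_finite P hfin

end Dichotomy


end Summit.ValiantsHypothesis.ValiantsHypothesis.Theorems.LangWeilTransfer
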